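import Summits.QuantumFields.BalabanUV.Beta.GAN24.ContactOneGaugeCellLambda
import Summits.QuantumFields.BalabanUV.Beta.GAN24.Push3GaugeSlotCells
import Summits.QuantumFields.BalabanUV.Beta.GAN24.Push3LegTelescope

/-!
# `GAN24.Push3LambdaGaugeSlotCells` — CT-ROUTE «CT-3cV-KERNEL», Λ half (the row owner's `BORNSEC-PLAN-v0.md` item (V6)): A PURE-GAUGE LEG IN ANY SLOT OF THE
# PUSH `push₃ l r w SΛ` OF THE Λ-PIECE `SΛ = SLam L c (hessFFAt ρ L)`, part 1: locality ∕ window ∕ size of `SΛ`, and the LEFT slot = the Λ one-gauge cell sum of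
# `ContactOneGaugeCellLambda` (right leg outer, index leg inner; one exchange «finite fluctuation window × summable index site»)

HONEST FRAMING (cell charter, verbatim): «discharging `BetaPertH` makes Bałaban's UV stability UNCONDITIONAL — a real constructive-QFT result;
it is NOT the continuum limit and NOT the Clay problem.»  DERIVED cell leaf (pub-balaban, G-an2-4 formalisation swarm → CRUX TEAM (2), seat
`b2b-balaban-gan24-formalise-leaf-02`, gen 47): leaf-01 g58's `Push3GaugeSlotCells` ∕ `ContactKernelCells` scripts re-run for the ff-valued, ANTISYMMETRIC, NOT finitely
supported (the coefficient family decays) Λ table, over this lineage's `HessianGaugeLegContact.tsum_dz_mul_SLam_hessFFAt` and `ContactOneGaugeCellLambda`, an1's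
`hessKerAt_eq_zero_*` ∕ `abs_hessKerAt_le` ∕ `biLoc_hessFFAt`, lit's `InterLevelTransport.locStencil_SLam` and leaf-17∕leaf-01's `Push4NestAux` ∕ `Push3LegTelescope` BY NAME;
[folklore] bookkeeping; NO cited fact, NO `def`, NO `def … : Prop`, NO wall binder; the coefficient family is ARBITRARY under a displayed decay letter and (for the table
slot) a displayed TRANSVERSALITY hypothesis.  Discharges NO letter of (CONV-C): the route's INSTANCE and the assembly (V8) are the owner's ∕ leaf-03's; NEVER
«G-an2-4 closed»; NOT hS0, NOT D1, NOT `BetaPertH`, NOT continuum, NOT Clay.  «not in print; our bookkeeping».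
HONEST DEPENDENCY (cell records, verbatim): «continuum YM on T⁴ ⇐ BetaPertH ∧ nine spine estimates (0/9 proved); BetaPertH ⇐ (D1) ∧ (D4) ∧ CAP+tail;
G-an2-4 gates asym, D1 and NE2/3/4.»
ABSOLUTE RULE (cell charter, verbatim): «No internally-minted statement may enter as a cited fact. Every hypothesis is either kernel-proved in this
package or a verbatim quotation of a PUBLISHED theorem with page reference. The manuscript(s) under audit are NOT citable for their own disputed steps —
they are the thing under adjudication; programme-internal (2001/route/tribunal) claims are never citable.»

## What is proved (box root `ρ = toSite rr`, `rr ∈ box (d+1) L`, `1 ≤ L`; `SΛ := SLam L c (fun μ y => hessFFAt ρ L μ y)`; coefficient letter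
`hc : |c μ y κ u| ≤ C_c·e^{−δ|L·y − u|₁}`, `0 < δ`; legs `l r w` coarse bond ↦ fine 1-form; gauge functions `λ μ y : Site → ℝ`; generic `d`)
* §1 locality ∕ window ∕ size: `locStencil_SLam_hessFFAt` (rate `δ∕2`), `SLam_hessFFAt_eq_zero_of_not_window` (`x − z ∈ [−(2L−1), 2L−1]^{d+1}`), `abs_SLam_hessFFAt_le_sum`,
  `summable_mul_SLam_hessFFAt_idx` (summable in the INDEX site against any bounded weight), `vertexW_lambda_antisymm`, `vertexW_lambda_eq_zero_of_not_window`,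
  `exists_vertexW_lambda_bound`.
* §2 LEFT SLOT (one exchange «finite `x`-window × summable `u`»): `inner_gaugeLeft_lambda`, **`push₃_gaugeLeft_lambda`**
  `push₃ (dz λ) r w SΛ κ′ u′ x′ z′ (inl α) (inl β) = Σ'_z Σ_b r β z′ b z · Σ'_u Σ_κ w κ′ u′ κ u · KΛ(λ_{αx′}; κ,u; b,z)`,
  `KΛ(ψ; κ,u; b,z) = −Σ_μ Σ'_y c μ y κ u·((ψ z + ψ(z + e_b) − ψ(L·y + ρ) − ψ(L·y + ρ + L·e_μ))·q¹,ρ_{(μ,y)}(b, z)∕2)` — `ContactOneGaugeCellLambda.cellLambda_eq`'s nesting.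
Sequel `GAN24.Push3LambdaKernelCells`: the TABLE slot (= 0 for a transversal family), the transposition ∕ RIGHT slot, and the kernel socket `contact_lambda_eq_cells`.
Provenance: seat b2b-balaban-gan24-formalise-leaf-02 gen 47 (prover-…-leaf-02-g47-0), 2026-08-21; over the files named above BY NAME.
-/

open Finset
open scoped BigOperators Nat
open Literature.MathematicalPhysics.QuantumFieldTheory.LatticeForm (quo)
open Literature.MathematicalPhysics.QuantumFieldTheory.Balaban1983to89
open Literature.MathematicalPhysics.QuantumFieldTheory.Balaban1983to89.Beta
open AffineAveraging AveragingContours AveragingHessianKernels AveragingContoursRooted AveragingHessianKernelsRooted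
open B12Sec2to5 (l1 l1_nonneg)
open B4ContourShift (supNorm supNorm_nonneg)
open ExpKernelCalculus (MKer Decays VertexFamily Zl Zl_nonneg Zl_pos summable_exp_shift)
open OneStepResolventKernel (Fib LocStencil)
open InterLevelTransport (SLam locStencil_SLam)
open KernelWard (divV)
open AveragingWardStencils (b6UnitVec_eq)
open Summit.QuantumFields.BalabanUV.Beta.LinearGaugeVH (nearBox mem_nearBox summable_of_finsupp)
open Summit.QuantumFields.BalabanUV.Beta.GAN24.HessianGaugeLegContact (SLam_hessFFAt_inl_inl SLam_hessFFAt_antisymm exists_finset_near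
  tsum_coeff_mul_hessKerAt_eq_sum SLam_hessFFAt_inl_inl_eq_zero_of_not_mem tsum_dz_mul_SLam_hessFFAt)
open Summit.QuantumFields.BalabanUV.Beta.GAN24.Push4 (vertexW vertexW_apply)
open Summit.QuantumFields.BalabanUV.Beta.GAN24.Push4NestAux (decays_vertexW_of_locStencil abs_le_of_decays)
open Summit.QuantumFields.BalabanUV.Beta.GAN24.Push3 (push₃ push₃_inl_inl)
open Summit.QuantumFields.BalabanUV.Beta.GAN24.Push3GaugeSlotCells (tsum_comm_of_window)
open Summit.QuantumFields.BalabanUV.Beta.GAN24.Push3LegTelescope (push₃_sub_left push₃_sub_right push₃_sub_table)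

noncomputable section

namespace Summit.QuantumFields.BalabanUV.Beta.GAN24.Push3LambdaGaugeSlotCells

variable {d : ℕ}
variable (l r w : Fin (d + 1) → (Fin (d + 1) → ℤ) → Fin (d + 1) → (Fin (d + 1) → ℤ) → ℝ)
variable (lam : Fin (d + 1) → (Fin (d + 1) → ℤ) → (Fin (d + 1) → ℤ) → ℝ)

/-! ## §1 Locality, window and size of the Λ-piece -/

section Locality

variable {L : ℕ} {rr : Fin (d + 1) → ℕ} {c : Fin (d + 1) → (Fin (d + 1) → ℤ) → Fin (d + 1) → (Fin (d + 1) → ℤ) → ℝ} {Cc δ : ℝ}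

/-- [folklore] **THE Λ-PIECE IS A LOCAL STENCIL FAMILY** (box root; coefficient letter at rate `δ`; an1's `biLoc_hessFFAt`, lit's `locStencil_SLam`), rate `δ∕2`. -/
theorem locStencil_SLam_hessFFAt (hL : 1 ≤ L) (hrr : rr ∈ box (d + 1) L) (hc : ∀ μ y κ u, |c μ y κ u| ≤ Cc * Real.exp (-δ * l1 ((L : ℤ) • y - u)))
    (hδ : 0 < δ) (hCc : 0 ≤ Cc) :
    LocStencil (SLam L c (fun μ y => hessFFAt (toSite rr) L μ y))
      ((d + 1 : ℕ) * (Cc * (2 * (ell (d + 1) L : ℝ) ^ 2 * Real.exp (4 * ((d : ℝ) + 1) * L * δ)) * Zl (d + 1) (δ / 2))) (δ / 2) := by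
  haveI : NeZero L := ⟨by omega⟩
  exact locStencil_SLam (N := L) hc (fun μ y => biLoc_hessFFAt hL μ y hrr hδ.le) hδ hCc

/-- [folklore] THE WINDOW: both fluctuation sites of a nonzero entry lie in the support box of ONE coarse bond, so `x − z ∈ [−(2L−1), 2L−1]^{d+1}`. -/
theorem SLam_hessFFAt_eq_zero_of_not_window [NeZero L] (hrr : rr ∈ box (d + 1) L) (κ : Fin (d + 1)) (u : Fin (d + 1) → ℤ) {x z : Fin (d + 1) → ℤ}
    (a b : Fin (d + 1)) (hxz : x - z ∉ Fintype.piFinset fun _ : Fin (d + 1) => Finset.Icc (-(2 * (L : ℤ) - 1)) (2 * (L : ℤ) - 1)) :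
    SLam L c (fun μ y => hessFFAt (toSite rr) L μ y) κ u x z (Sum.inl a) (Sum.inl b) = 0 := by
  rw [SLam_hessFFAt_inl_inl, neg_eq_zero]
  refine Finset.sum_eq_zero fun μ _ => ?_
  have hterm : ∀ y, c μ y κ u * hessKerAt (toSite rr) L μ y (a, x) (b, z) = 0 := by
    intro y
    by_cases hx : Near L y x
    · by_cases hz : Near L y z
      · exfalso
        refine hxz (Fintype.mem_piFinset.2 fun i => Finset.mem_Icc.2 ?_)
        obtain ⟨hx1, hx2⟩ := hx i
        obtain ⟨hz1, hz2⟩ := hz i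
        simp only [Pi.sub_apply]
        constructor <;> linarith
      · rw [hessKerAt_eq_zero_right hrr _ (f' := (b, z)) hz, mul_zero]
    · rw [hessKerAt_eq_zero_left hrr (f := (a, x)) hx _, mul_zero]
  simp only [hterm, tsum_zero]

/-- [folklore] SIZE, termwise: for a finite set `s` containing every coarse site near the second fluctuation site,
`|SΛ κ u x z (inl a) (inl b)| ≤ Σ_μ Σ_{y ∈ s} (C_c·2ℓ²)·e^{−δ|L·y − u|₁}` (`abs_hessKerAt_le`). -/
theorem abs_SLam_hessFFAt_le_sum [NeZero L] (hL : 1 ≤ L) (hrr : rr ∈ box (d + 1) L) (hc : ∀ μ y κ u, |c μ y κ u| ≤ Cc * Real.exp (-δ * l1 ((L : ℤ) • y - u)))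
    (hCc : 0 ≤ Cc) {s : Finset (Fin (d + 1) → ℤ)} {z : Fin (d + 1) → ℤ} (hs : ∀ y, Near L y z → y ∈ s) (κ : Fin (d + 1)) (u x : Fin (d + 1) → ℤ)
    (a b : Fin (d + 1)) :
    |SLam L c (fun μ y => hessFFAt (toSite rr) L μ y) κ u x z (Sum.inl a) (Sum.inl b)|
      ≤ ∑ _μ : Fin (d + 1), ∑ y ∈ s, (Cc * (2 * (ell (d + 1) L : ℝ) ^ 2)) * Real.exp (-δ * l1 ((L : ℤ) • y - u)) := by
  rw [SLam_hessFFAt_inl_inl, abs_neg]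
  simp only [tsum_coeff_mul_hessKerAt_eq_sum hrr hs]
  refine (Finset.abs_sum_le_sum_abs _ _).trans (Finset.sum_le_sum fun μ _ => ?_)
  refine (Finset.abs_sum_le_sum_abs _ _).trans (Finset.sum_le_sum fun y _ => ?_)
  rw [abs_mul]
  calc |c μ y κ u| * |hessKerAt (toSite rr) L μ y (a, x) (b, z)|
      ≤ (Cc * Real.exp (-δ * l1 ((L : ℤ) • y - u))) * (2 * (ell (d + 1) L : ℝ) ^ 2) :=
        mul_le_mul (hc μ y κ u) (abs_hessKerAt_le hL μ y hrr _ _) (abs_nonneg _) (by positivity)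
    _ = _ := by ring

/-- [folklore] **SUMMABILITY IN THE INDEX SITE against any bounded weight** (the coefficient family decays in `u`). -/
theorem summable_mul_SLam_hessFFAt_idx [NeZero L] (hL : 1 ≤ L) (hrr : rr ∈ box (d + 1) L)
    (hc : ∀ μ y κ u, |c μ y κ u| ≤ Cc * Real.exp (-δ * l1 ((L : ℤ) • y - u))) (hδ : 0 < δ) (hCc : 0 ≤ Cc) {g : (Fin (d + 1) → ℤ) → ℝ} {Cg : ℝ}
    (hg : ∀ u, |g u| ≤ Cg) (κ : Fin (d + 1)) (x z : Fin (d + 1) → ℤ) (a b : Fin (d + 1)) :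
    Summable fun u => g u * SLam L c (fun μ y => hessFFAt (toSite rr) L μ y) κ u x z (Sum.inl a) (Sum.inl b) := by
  obtain ⟨s, hs⟩ := exists_finset_near hL z
  have hCg : 0 ≤ Cg := (abs_nonneg _).trans (hg 0)
  have hmaj : Summable fun u => Cg * ∑ μ : Fin (d + 1), ∑ y ∈ s, (Cc * (2 * (ell (d + 1) L : ℝ) ^ 2)) * Real.exp (-δ * l1 ((L : ℤ) • y - u)) :=
    (summable_sum fun μ _ => summable_sum fun y _ => (summable_exp_shift hδ ((L : ℤ) • y)).mul_left _).mul_left Cg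
  refine Summable.of_norm_bounded hmaj (fun u => ?_)
  rw [Real.norm_eq_abs, abs_mul]
  exact mul_le_mul (hg u) (abs_SLam_hessFFAt_le_sum hL hrr hc hCc hs κ u x a b) (abs_nonneg _) hCg

/-- [folklore] The table vertex of the Λ-piece inherits its ANTISYMMETRY (`SLam_hessFFAt_antisymm` under the index sum). -/
theorem vertexW_lambda_antisymm [NeZero L] (ρ : Fin (d + 1) → ℤ) (κ' : Fin (d + 1)) (u' x z : Fin (d + 1) → ℤ) (a b : Fin (d + 1)) :
    vertexW w (SLam L c (fun μ y => hessFFAt ρ L μ y)) κ' u' x z (Sum.inl a) (Sum.inl b)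
      = -vertexW w (SLam L c (fun μ y => hessFFAt ρ L μ y)) κ' u' z x (Sum.inl b) (Sum.inl a) := by
  rw [vertexW_apply, vertexW_apply, ← Finset.sum_neg_distrib]
  refine Finset.sum_congr rfl fun κ _ => ?_
  rw [← tsum_neg]
  refine tsum_congr fun u => ?_
  rw [SLam_hessFFAt_antisymm ρ L c κ u z x (Sum.inl b) (Sum.inl a)]
  ring

/-- [folklore] The table vertex inherits the WINDOW. -/
theorem vertexW_lambda_eq_zero_of_not_window [NeZero L] (hrr : rr ∈ box (d + 1) L) (κ' : Fin (d + 1)) (u' : Fin (d + 1) → ℤ) {x z : Fin (d + 1) → ℤ}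
    {a b : Fin (d + 1)} (hxz : x - z ∉ Fintype.piFinset fun _ : Fin (d + 1) => Finset.Icc (-(2 * (L : ℤ) - 1)) (2 * (L : ℤ) - 1)) :
    vertexW w (SLam L c (fun μ y => hessFFAt (toSite rr) L μ y)) κ' u' x z (Sum.inl a) (Sum.inl b) = 0 := by
  rw [vertexW_apply]
  refine Finset.sum_eq_zero fun κ _ => ?_
  simp only [SLam_hessFFAt_eq_zero_of_not_window hrr κ _ a b hxz, mul_zero, tsum_zero]

/-- [folklore] SIZE of the table vertex for bounded table legs (`locStencil_SLam_hessFFAt` + leaf-17's `decays_vertexW_of_locStencil`). -/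
theorem exists_vertexW_lambda_bound (hL : 1 ≤ L) (hrr : rr ∈ box (d + 1) L) (hc : ∀ μ y κ u, |c μ y κ u| ≤ Cc * Real.exp (-δ * l1 ((L : ℤ) • y - u)))
    (hδ : 0 < δ) (hCc : 0 ≤ Cc) {Cw : ℝ} (hw : ∀ κ' u' κ u, |w κ' u' κ u| ≤ Cw) (κ' : Fin (d + 1)) (u' : Fin (d + 1) → ℤ) :
    ∃ CV : ℝ, 0 ≤ CV ∧ ∀ x z a b, |vertexW w (SLam L c (fun μ y => hessFFAt (toSite rr) L μ y)) κ' u' x z a b| ≤ CV := by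
  have hCw : 0 ≤ Cw := (abs_nonneg _).trans (hw 0 0 0 0)
  have hV := decays_vertexW_of_locStencil hw hCw (locStencil_SLam_hessFFAt hL hrr hc hδ hCc) (by positivity) κ' u'
  exact ⟨_, (abs_nonneg _).trans (abs_le_of_decays hV (by positivity) 0 0 (Sum.inl 0) (Sum.inl 0)),
    fun x z a b => abs_le_of_decays hV (by positivity) x z a b⟩

end Locality

/-! ## §2 THE LEFT SLOT: a pure-gauge first-slot leg reads as the Λ cell (right leg outer, index leg inner) -/

section Left

variable {L : ℕ} {rr : Fin (d + 1) → ℕ} {c : Fin (d + 1) → (Fin (d + 1) → ℤ) → Fin (d + 1) → (Fin (d + 1) → ℤ) → ℝ} {Cc δ Cw : ℝ}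

/-- [folklore] **THE LEFT LEG AGAINST THE Λ VERTEX, INDEX LEG OUTSIDE** (one exchange: the fluctuation site runs over a FINITE window about the right site, the index
site over a SUMMABLE family; then `HessianGaugeLegContact.tsum_dz_mul_SLam_hessFFAt` under the binders):
`Σ'_x Σ_a (dz ψ)_a x · vertexW w SΛ κ′ u′ x z (inl a) (inl b) = Σ'_u Σ_κ w κ′ u′ κ u · KΛ(ψ; κ,u; b,z)`. -/
theorem inner_gaugeLeft_lambda (hL : 1 ≤ L) (hrr : rr ∈ box (d + 1) L) (hc : ∀ μ y κ u, |c μ y κ u| ≤ Cc * Real.exp (-δ * l1 ((L : ℤ) • y - u)))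
    (hδ : 0 < δ) (hCc : 0 ≤ Cc) (hw : ∀ κ' u' κ u, |w κ' u' κ u| ≤ Cw) (ψ : (Fin (d + 1) → ℤ) → ℝ) (κ' : Fin (d + 1)) (u' z : Fin (d + 1) → ℤ)
    (b : Fin (d + 1)) :
    ∑' x, ∑ a, dz ψ a x * vertexW w (SLam L c (fun μ y => hessFFAt (toSite rr) L μ y)) κ' u' x z (Sum.inl a) (Sum.inl b)
      = ∑' u, ∑ κ, w κ' u' κ u *
          -(∑ μ, ∑' y, c μ y κ u *
            ((ψ z + ψ (z + unitVec b) - ψ ((L : ℤ) • y + toSite rr) - ψ ((L : ℤ) • y + toSite rr + (L : ℤ) • unitVec μ))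
              * linKerAt (toSite rr) L μ y (b, z) / 2)) := by
  classical
  haveI : NeZero L := ⟨by omega⟩
  set S := SLam L c (fun μ y => hessFFAt (toSite rr) L μ y) with hSdef
  obtain ⟨s, hs⟩ := exists_finset_near hL z
  set X : Finset (Fin (d + 1) → ℤ) := s.biUnion fun y => nearBox L y with hX
  -- the `x`-window and the `u`-summability
  have hxzero : ∀ x ∉ X, ∀ κ u a, S κ u x z (Sum.inl a) (Sum.inl b) = 0 :=
    fun x hx κ u a => SLam_hessFFAt_inl_inl_eq_zero_of_not_mem hrr hs c κ u a b hx
  have hsu : ∀ x a κ, Summable fun u => dz ψ a x * (w κ' u' κ u * S κ u x z (Sum.inl a) (Sum.inl b)) := by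
    intro x a κ
    have h := (summable_mul_SLam_hessFFAt_idx hL hrr hc hδ hCc (g := fun u => w κ' u' κ u) (hw κ' u' κ) κ x z a b).mul_left (dz ψ a x)
    exact h.congr fun u => by rw [hSdef]
  -- the left-hand side as `Σ_{x ∈ X} Σ'_u Φ x u`
  have hLHS : ∀ x, (∑ a, dz ψ a x * vertexW w S κ' u' x z (Sum.inl a) (Sum.inl b))
      = ∑' u, ∑ a, ∑ κ, dz ψ a x * (w κ' u' κ u * S κ u x z (Sum.inl a) (Sum.inl b)) := by
    intro x
    calc (∑ a, dz ψ a x * vertexW w S κ' u' x z (Sum.inl a) (Sum.inl b))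
        = ∑ a, ∑ κ, ∑' u, dz ψ a x * (w κ' u' κ u * S κ u x z (Sum.inl a) (Sum.inl b)) := by
          refine Finset.sum_congr rfl fun a _ => ?_
          rw [vertexW_apply, Finset.mul_sum]
          refine Finset.sum_congr rfl fun κ _ => ?_
          rw [← tsum_mul_left]
      _ = ∑ a, ∑' u, ∑ κ, dz ψ a x * (w κ' u' κ u * S κ u x z (Sum.inl a) (Sum.inl b)) := by
          refine Finset.sum_congr rfl fun a _ => ?_
          rw [Summable.tsum_finsetSum fun κ _ => hsu x a κ]
      _ = _ := by rw [Summable.tsum_finsetSum fun a _ => summable_sum fun κ _ => hsu x a κ]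
  have hLHS0 : ∀ x ∉ X, (∑' u, ∑ a, ∑ κ, dz ψ a x * (w κ' u' κ u * S κ u x z (Sum.inl a) (Sum.inl b))) = 0 := by
    intro x hx
    have : ∀ u, (∑ a, ∑ κ, dz ψ a x * (w κ' u' κ u * S κ u x z (Sum.inl a) (Sum.inl b))) = 0 := fun u =>
      Finset.sum_eq_zero fun a _ => Finset.sum_eq_zero fun κ _ => by rw [hxzero x hx κ u a, mul_zero, mul_zero]
    simp only [this, tsum_zero]
  rw [tsum_congr hLHS, tsum_eq_sum (s := X) hLHS0,
    ← Summable.tsum_finsetSum (fun x _ => summable_sum fun a _ => summable_sum fun κ _ => hsu x a κ)]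
  refine tsum_congr fun u => ?_
  -- back to the full `x`-sum inside, then the Λ law
  have hRHS : (∑ κ, w κ' u' κ u * ∑' x, ∑ a, dz ψ a x * S κ u x z (Sum.inl a) (Sum.inl b))
      = ∑ x ∈ X, ∑ a, ∑ κ, dz ψ a x * (w κ' u' κ u * S κ u x z (Sum.inl a) (Sum.inl b)) := by
    have hin : ∀ κ, ∑' x, ∑ a, dz ψ a x * S κ u x z (Sum.inl a) (Sum.inl b) = ∑ x ∈ X, ∑ a, dz ψ a x * S κ u x z (Sum.inl a) (Sum.inl b) :=
      fun κ => tsum_eq_sum fun x hx => Finset.sum_eq_zero fun a _ => by rw [hxzero x hx κ u a, mul_zero]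
    simp only [hin, Finset.mul_sum]
    rw [Finset.sum_comm]
    refine Finset.sum_congr rfl fun x _ => ?_
    rw [Finset.sum_comm]
    refine Finset.sum_congr rfl fun a _ => Finset.sum_congr rfl fun κ _ => ?_
    ring
  rw [← hRHS]
  refine Finset.sum_congr rfl fun κ _ => ?_
  rw [hSdef, tsum_dz_mul_SLam_hessFFAt hL hrr c κ u z b ψ]

/-- [folklore] **THE LEFT SLOT**: with a pure-gauge LEFT leg family, every field entry of the push of the Λ-piece is the Λ one-gauge cell sum
(`ContactOneGaugeCellLambda.cellLambda_eq`'s nesting: right leg OUTER, index leg INSIDE):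
`push₃ (dz λ) r w SΛ κ′ u′ x′ z′ (inl α) (inl β) = Σ'_z Σ_b r β z′ b z · Σ'_u Σ_κ w κ′ u′ κ u · KΛ(λ_{αx′}; κ,u; b,z)`. -/
theorem push₃_gaugeLeft_lambda (hL : 1 ≤ L) (hrr : rr ∈ box (d + 1) L) (hc : ∀ μ y κ u, |c μ y κ u| ≤ Cc * Real.exp (-δ * l1 ((L : ℤ) • y - u)))
    (hδ : 0 < δ) (hCc : 0 ≤ Cc) (hw : ∀ κ' u' κ u, |w κ' u' κ u| ≤ Cw) (κ' : Fin (d + 1)) (u' x' z' : Fin (d + 1) → ℤ) (α β : Fin (d + 1)) :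
    push₃ (fun μ y κ u => dz (lam μ y) κ u) r w (SLam L c (fun μ y => hessFFAt (toSite rr) L μ y)) κ' u' x' z' (Sum.inl α) (Sum.inl β)
      = ∑' z, ∑ b, r β z' b z * ∑' u, ∑ κ, w κ' u' κ u *
          -(∑ μ, ∑' y, c μ y κ u *
            ((lam α x' z + lam α x' (z + unitVec b) - lam α x' ((L : ℤ) • y + toSite rr) - lam α x' ((L : ℤ) • y + toSite rr + (L : ℤ) • unitVec μ))
              * linKerAt (toSite rr) L μ y (b, z) / 2)) := by
  rw [push₃_inl_inl]
  refine tsum_congr fun z => Finset.sum_congr rfl fun b _ => ?_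
  rw [mul_comm, inner_gaugeLeft_lambda w hL hrr hc hδ hCc hw (lam α x') κ' u' z b]

end Left

end Summit.QuantumFields.BalabanUV.Beta.GAN24.Push3LambdaGaugeSlotCells

end
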